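import Summits.ValiantsHypothesis.ValiantsHypothesis.Theorems.GrenetZeonDualUnipotentThreeHalvesHeavyTopCodimOneBlocks
import Summits.ValiantsHypothesis.ValiantsHypothesis.Theorems.GrenetZeonDualUnipotentThreeHalvesHeavyTopIrreducibleData

/-!
# `GrenetZeon.DualUnipotentThreeHalves` (stmt-ValiantsHypothesis-24318), R2 heavy-top instrument — an irreducible nilpotent space contains an
# element of nilindex `≥ 3` (not square-zero)

First half of the nilindex corollary of COROLLARY II suggested by the lead (EXTREMISERS X16 addendum: «towers have generic index m»): an IRREDUCIBLE
nilpotent space `W ≤ M_s(ℂ)`, `s ≥ 2`, contains a matrix `A` with `A² ≠ 0` — otherwise `W` is square-zero, its members anticommute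
(✓ `HeavyTopIrreducibleData.reducible_of_sq_zero`), and the kernel of any non-zero member is a non-trivial proper invariant subspace
(`W = ⊥` is reducible too, ✓ `HeavyTopCodimOneBlocks.not_irreducible_bot`).  In particular the irreducible plane `I ≤ M₃(ℂ)` of a tower
`T(p, I, q)` contains a REGULAR nilpotent `3 × 3` matrix (`A² ≠ 0 = A³`).

* ★ `exists_sq_ne_zero_of_irreducible` — the statement.

Honest framing: linear algebra; nothing here proves or refutes `HeavyTopLaw`, 24318, S3b or 8062; `VP ≠ VNP` is NOT proved.  No definitions.
[folklore; cell val-heavytop-census, eng-1 g5]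
-/

noncomputable section

-- single-conjunct layout: Sub = Summit, duplicated namespace component intended
set_option linter.dupNamespace false

namespace Summit.ValiantsHypothesis.ValiantsHypothesis.Theorems.GrenetZeon.HeavyTopCodimOneBlocks

open Matrix
open Summit.ValiantsHypothesis.ValiantsHypothesis.Theorems.GrenetZeon.HeavyTopIrreducibleData (reducible_of_sq_zero)

/-- ★ **An irreducible nilpotent space (`s ≥ 2`) is not square-zero:** it contains `A` with `A * A ≠ 0`. [folklore] -/
theorem exists_sq_ne_zero_of_irreducible {s : ℕ} (hs : 2 ≤ s) (W : Submodule ℂ (Matrix (Fin s) (Fin s) ℂ)) (hW : ∀ A ∈ W, IsNilpotent A)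
    (hirr : ∀ U : Submodule ℂ (Fin s → ℂ), (∀ A ∈ W, ∀ x ∈ U, A *ᵥ x ∈ U) → U = ⊥ ∨ U = ⊤) :
    ∃ A ∈ W, A * A ≠ 0 := by
  classical
  by_contra hsq
  have hsq' : ∀ A ∈ W, A * A = 0 := fun A hA => by
    by_contra h; exact hsq ⟨A, hA, h⟩
  -- `W ≠ ⊥`
  by_cases hbot : W = ⊥
  · subst hbot
    exact not_irreducible_bot hs hirr
  obtain ⟨A, hA, hA0⟩ := Submodule.exists_mem_ne_zero_of_ne_bot hbot
  -- a vector not killed by `A`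
  obtain ⟨x, hx⟩ : ∃ x : Fin s → ℂ, A *ᵥ x ≠ 0 := by
    by_contra hall
    apply hA0
    ext i j
    have h := Classical.not_not.1 (fun hne => hall ⟨Pi.single j 1, hne⟩)
    have := congrFun h i
    simpa [Matrix.mulVec, dotProduct, Pi.single_apply] using this
  -- the kernel of `A` is invariant, non-zero and proper
  let U : Submodule ℂ (Fin s → ℂ) := LinearMap.ker (Matrix.toLin' A)
  have hUmem : ∀ y, y ∈ U ↔ A *ᵥ y = 0 := fun y => by
    change Matrix.toLin' A y = 0 ↔ _
    rw [Matrix.toLin'_apply]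
  rcases hirr U (fun B hB y hy => (hUmem _).2 (reducible_of_sq_zero W hsq' hA hB y ((hUmem y).1 hy))) with h | h
  · -- `A x ∈ U` is non-zero
    have hmem : A *ᵥ x ∈ U := (hUmem _).2 (by rw [Matrix.mulVec_mulVec, hsq' A hA, Matrix.zero_mulVec])
    rw [h, Submodule.mem_bot] at hmem
    exact hx hmem
  · have hmem : x ∈ U := by rw [h]; exact Submodule.mem_top
    exact hx ((hUmem x).1 hmem)

end Summit.ValiantsHypothesis.ValiantsHypothesis.Theorems.GrenetZeon.HeavyTopCodimOneBlocks

end
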